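import Summits.BirchSwinnertonDyer.Rank1Residual.X11b.Three.KolyvaginShaOrderThreeDischarged
import Summits.BirchSwinnertonDyer.Rank1Residual.X11b.Three.KolyvaginShaThreeOfProp37
import HarnessLib

/-!
# Kolyvagin's ORDER bound `#Ш(E/K)[3^∞] ≤ 3^{2·ord_3 [E(K):ℤ y_K]}` on the class X11b @ 3 ∩ (KN₃)/ℚ
# modulo ONE NAMED published fact — Gross 1991 Prop. 3.7 (2) BY NAME — and the Cassels–Tate inputs
# (the X11b @ 3 ORDER ENDs with the last inline cite-only binder `hγ` RE-POINTED)

Cell `b2b-bsdres`, team x11b3 (N8/O2 = X11b @ 3); seat x11b3-p2 GEN 53 (unit claimed D-0075 →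
BSD:K2/P4 «Kolyvagin-in-kernel», ladder rows P4/P5).  Summit-side THEOREM-ONLY file (no definition,
no named fact, no `sorry`); `K : Type`; the literal prime `3`.

HONEST FRAMING (cell `b2b-bsdres`, run/shared/lean/b2b/bsd-rank1-residual/, verbatim in every
file): the goal of the cell is to DELETE the COMBINATION-SHAPED residual classes of the
Birch–Swinnerton-Dyer formula for ALL analytic-rank `≤ 1` elliptic curves over `ℚ` — "full BSD
formula for every rank `≤ 1` curve in class `C`" assembled STRICTLY from published theorems — so
that the rank-`≤ 1` remainder becomes exactly the CONSTRUCTION-SHAPED classes, which are TYPED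
(missing-input `Prop`s), NOT attempted.  This is not "finishing BSD".  Nothing here is booked; no
mark / label / count / tier moves; X11b @ 3 = O2/B10 stays OPEN / CONSTRUCTION-SHAPED.

WHAT THIS FILE DOES (b2b-bsdres REFEREE 2 GEN 192 nit n202, second half; lit GEN 154 P.S.,
HOME/INBOX 2026-08-27T12:26:08Z).  The two ORDER ENDs of `X11b/Three/KolyvaginShaOrderThreeDischarged`
(x11b3-p2 GEN 52; ladder P4 at `3` on the class: `Ш(E/K)[3^∞]` finite ∧ `3^{M₀}`-torsion ∧
`# ≤ 3^{2M₀}` ∧ `ord_3 # ≤ 2M₀`, with `M₀` the exact `3`-divisibility of `y_K`, resp.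
`M₀ = ord_3 [E(K) : ℤ y_K]`) carry EXACTLY ONE inline cite-only binder `hγ` (Gross 1991 Prop. 3.7 (2)
at `3`) next to the displayed Cassels–Tate inputs.  That proposition is now the NAMED Literature
fact `GrossLMS1991.prop37_2_reductionCongruence N W K p` (lit GEN 154, p530891, §E E622), and on
the class X11b @ 3 ∩ (KN₃)/ℚ at `N = N_E` its six standing hypotheses are tree theorems
(`prop37_endBinder_three_of_classX11b`, `X11b/Three/KolyvaginShaThreeOfProp37` §0).  THIS FILE
re-issues both ENDs with `hγ` TAKEN BY NAME — `(hγ : prop37_2_reductionCongruence N W K 3)` —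
every other binder (incl. the Cassels–Tate inputs) and the conclusion VERBATIM; proof = the parent
END applied to §0.  The second theorem is the `hB` shape (`Kolyvagin1990_padicValNat_card_sha_le`
at `3`, `3`-primary part) of `bsdp_of_classX11b_three_of_onTreeInputs`, now MODULO {the named fact}
+ `hN` + (KN₃)/ℚ + the Cassels–Tate inputs — not the fact itself; nothing booked.

## What is proved (namespace `Summit.BirchSwinnertonDyer.Rank1Residual.X11b.Three.KolyvaginDischarged`)

* `card_sha_three_primary_le_of_classX11b_of_kodairaNeron_rat_of_localDuality_of_prop37` —
  `ord_3 #Ш(E/K)[3^∞] ≤ 2M₀` for `3^{M₀} x₀ = y_K ∉ 3^{M₀+1}E(K)`.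
* `card_sha_three_primary_le_of_classX11b_of_kodairaNeron_rat_index_of_localDuality_of_prop37` —
  `ord_3 #Ш(E/K)[3^∞] ≤ 2 · ord_3 [E(K) : ℤ y_K]`.
Each modulo EXACTLY the named fact at `3` + `hN` + (KN₃)/ℚ + the Cassels–Tate inputs.

## References

* [McCallumLMS1991] W. G. McCallum, LMS LNS 153 (1991), §1 Theorem p. 296, Lemma 5.1 (p. 303),
  Prop. 4.7, Lemma 5.3, Thm. 5.4, Cor. 5.6.
* [GrossLMS1991] B. H. Gross, same volume, Prop. 2.1 (2), Thm. 2.2 (2), §3 Prop. 3.7 (2) (p. 240),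
  Prop. 5.3, §10.
* [MilneADT2006] I §6 Prop. 6.9, Thm. 6.13(a). [Serre1972] §2.4 Prop. 15. [Nekovar2007] Prop. 4.9.

presearch: `lean search 'of_localDuality_of_prop37'` → none; parents = the tree ENDs named above;
§0 = `X11b/Three/KolyvaginShaThreeOfProp37`; nothing minted.
-/

noncomputable section

namespace Summit.BirchSwinnertonDyer.Rank1Residual.X11b.Three.KolyvaginDischarged

open scoped Classical
open WeierstrassCurve Field NumberField IsDedekindDomain Function
open Literature.NumberTheory.EllipticCurves Literature.NumberTheory.GaloisRepresentations
open Literature.NumberTheory.EllipticCurves.Rank1Residual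
open Literature.NumberTheory.EllipticCurves.RingClassField
open Literature.NumberTheory.EllipticCurves.ModularForms
open Literature.NumberTheory.DiophantineGeometry Literature.NumberTheory.DiophantineGeometry.TateAlgorithm
open Literature.NumberTheory.GaloisCohomology
open Literature.NumberTheory.GaloisRepresentations.DiscreteGaloisModule (mu MuCarrier)
open Literature.NumberTheory.EllipticCurves.GrossLMS1991 (prop37_2_reductionCongruence)

-- `LocallyCompactSpace Γ_K` / `CharZero` of completions, as in the tree's Cassels–Tate files.
attribute [local instance] absoluteGaloisGroup_compactSpace charZero_placeCompletion

variable {K : Type} [Field K] [NumberField K] {N : ℕ} {W : WeierstrassCurve ℚ}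

/-- **On the class X11b @ 3 ∩ (KN₃)/ℚ: `ord_3 #Ш(E/K)[3^∞] ≤ 2M₀` — modulo the NAMED fact
`GrossLMS1991.prop37_2_reductionCongruence N W K 3` and the Cassels–Tate inputs, no inline
cite-only input, NO image hypothesis** — for `3^{M₀} x₀ = y_K ∉ 3^{M₀+1}E(K)`, `M₀ ≥ 1`.  The tree
END `card_sha_three_primary_le_of_classX11b_of_kodairaNeron_rat_of_localDuality`
(`X11b/Three/KolyvaginShaOrderThreeDischarged`) with its inline binder `hγ` SUPPLIED by
`prop37_endBinder_three_of_classX11b`; every other binder (incl. the displayed Cassels–Tate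
inputs) and the conclusion (finite ∧ `3^{M₀}`-torsion ∧ `# ≤ 3^{2M₀}` ∧ `ord_3 # ≤ 2M₀`) VERBATIM.
CONDITIONAL on EXACTLY the named fact {`hγ`} at `3` (PUBLISHED, NOT discharged) + `hN` + (KN₃)/ℚ
+ the Cassels–Tate inputs; nothing booked; no mark / count / tier moves.
[cite: McCallumLMS1991, §1 Theorem (Kolyvagin), Lemma 5.1, Cor. 5.6] [cite: GrossLMS1991, Thm. 2.2 (2), §3 Prop. 3.7 (2) (p. 240), §10]
[cite: MilneADT2006, Ch. I §6, Thm. 6.13(a)] [cite: Serre1972, §2.4 Prop. 15] -/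
theorem card_sha_three_primary_le_of_classX11b_of_kodairaNeron_rat_of_localDuality_of_prop37 [NeZero N]
    [W.IsGloballyMinimal] (hW : ClassX11b W 3) (hN : ∀ [W.IsElliptic], N = W.conductorNorm ℤ)
    (hKN3m : ∀ [W.IsElliptic] (v : HeightOneSpectrum (𝓞 ℚ)),
      W.HasMultiplicativeReductionAt v → ¬ 3 ∣ W.ordMinimalDiscriminant v)
    (hKN3a : ∀ [W.IsElliptic] (v : HeightOneSpectrum (𝓞 ℚ)), W.HasAdditiveReductionAt v →
      W.kodairaSymbolAt v ≠ KodairaSymbol.IV ∧ W.kodairaSymbolAt v ≠ KodairaSymbol.IVstar)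
    (hγ : prop37_2_reductionCongruence N W K 3) :
    ∀ [W.IsElliptic] (_hK : IsImaginaryQuadratic K) (_hH : SatisfiesHeegnerHypothesis N K)
      {P : (W.baseChange K).toAffine.Point} (_hP : IsHeegnerPoint N W K P)
      (_hnt : ¬ IsOfFinAddOrder P)
      {M₀ : ℕ} (_hM₀ : 1 ≤ M₀) [NeZero (3 ^ M₀)] {c : K ≃ₐ[ℚ] K} (_hc : c ≠ 1) (_hcc : c * c = 1)
      {x₀ : (W.baseChange K).toAffine.Point} (_hx₀ : 3 ^ M₀ • x₀ = P)
      (_hmax : ∀ Q : (W.baseChange K).toAffine.Point, 3 ^ (M₀ + 1) • Q ≠ P)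
      (e : geomTorsion (W.baseChange K) ((3 ^ M₀ * 3 ^ M₀ : ℕ) : ℤ) →
        geomTorsion (W.baseChange K) ((3 ^ M₀ * 3 ^ M₀ : ℕ) : ℤ) → AlgebraicClosure K)
      (hμ : ∀ S T, e S T ^ (3 ^ M₀ * 3 ^ M₀) = 1)
      (hadd₁ : ∀ S₁ S₂ T, e (S₁ + S₂) T = e S₁ T * e S₂ T)
      (hadd₂ : ∀ S T₁ T₂, e S (T₁ + T₂) = e S T₁ * e S T₂)
      (hgal : ∀ (σ : absoluteGaloisGroup K) (S T : geomTorsion (W.baseChange K) ((3 ^ M₀ * 3 ^ M₀ : ℕ) : ℤ)),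
        σ • e S T = e (σ • S) (σ • T))
      (halt : ∀ T, e T T = 1) (hnondeg : ∀ T, (∀ S, e S T = 1) → T = 0)
      (inv : LocalInvariants K (3 ^ M₀ * 3 ^ M₀)) (hPT' : inv.SumInvLocalizationEqZero)
      (hinv : ∀ v : HeightOneSpectrum (𝓞 K), Injective (inv (Sum.inr v)))
      (hH3 : ∀ x : galoisCohomology (mu K (3 ^ M₀ * 3 ^ M₀)) 3,
        (∀ v : Place K, galoisCohomology.localization (mu K (3 ^ M₀ * 3 ^ M₀)) v 3 x = 0) → x = 0)
      (hB : Literature.GroupTheory.FiniteAbelian.IsLevelPairing (3 ^ M₀)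
        (ctLevelPairing (W.baseChange K) (3 ^ M₀) e hμ hadd₁ hadd₂ hgal inv halt hPT' hH3
          (localTerm_finite_support (W := W.baseChange K) (m := 3 ^ M₀) (e := e) (hμ := hμ)
            (hadd₁ := hadd₁) (hadd₂ := hadd₂) (hgal := hgal) halt inv)))
      (hPτ : ∀ z ∈ selmerGroup (W.baseChange K) ((3 ^ M₀ * 3 ^ M₀ : ℕ) : ℤ),
        ∀ t ∈ selmerGroup (W.baseChange K) ((3 ^ M₀ * 3 ^ M₀ : ℕ) : ℤ),
        ctGeneralFun (W.baseChange K) (3 ^ M₀) e hμ hadd₁ hadd₂ hgal inv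
            (torsionH1ToH1 (W.baseChange K) _ (conjAct W c _ z))
            (torsionH1ToH1 (W.baseChange K) _ (conjAct W c _ t)) =
          ctGeneralFun (W.baseChange K) (3 ^ M₀) e hμ hadd₁ hadd₂ hgal inv
            (torsionH1ToH1 (W.baseChange K) _ z) (torsionH1ToH1 (W.baseChange K) _ t)),
      Finite (AddCommGroup.primaryComponent (W.baseChange K).sha 3) ∧
      (∀ c ∈ AddCommGroup.primaryComponent (W.baseChange K).sha 3, 3 ^ M₀ • c = 0) ∧
      Nat.card (AddCommGroup.primaryComponent (W.baseChange K).sha 3) ≤ 3 ^ (2 * M₀) ∧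
      padicValNat 3 (Nat.card (AddCommGroup.primaryComponent (W.baseChange K).sha 3)) ≤ 2 * M₀ :=
  card_sha_three_primary_le_of_classX11b_of_kodairaNeron_rat_of_localDuality hW hN hKN3m hKN3a
    (prop37_endBinder_three_of_classX11b hW hN hKN3m hγ)

/-- **McCallum 1991 §1 Theorem (Kolyvagin) at `p = 3` on the class X11b @ 3 ∩ (KN₃)/ℚ, printed
Heegner-INDEX form: `ord_3 #Ш(E/K)[3^∞] ≤ 2 · ord_3 [E(K) : ℤ y_K]`** (for `[E(K) : ℤ y_K]` finite),
with `Ш(E/K)[3^∞]` finite, killed by `3^{M₀}`, of order `≤ 3^{2M₀}`, `M₀ = ord_3 [E(K) : ℤ y_K]` —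
modulo the NAMED fact `GrossLMS1991.prop37_2_reductionCongruence N W K 3` and the Cassels–Tate
inputs.  The tree END `card_sha_three_primary_le_of_classX11b_of_kodairaNeron_rat_index_of_localDuality`
(`X11b/Three/KolyvaginShaOrderThreeDischarged`) with `hγ` SUPPLIED by
`prop37_endBinder_three_of_classX11b`; binders/conclusion otherwise VERBATIM.  This is the `hB`
shape (`Kolyvagin1990_padicValNat_card_sha_le` at `3`, `3`-primary part) of
`bsdp_of_classX11b_three_of_onTreeInputs`, MODULO {the named fact} + `hN` + (KN₃)/ℚ + the
Cassels–Tate inputs — NOT the fact itself; nothing booked; no mark.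
[cite: McCallumLMS1991, §1 Theorem (Kolyvagin), Lemma 5.1 (p. 303), Cor. 5.6]
[cite: GrossLMS1991, §2 Prop. 2.1 (2), Thm. 2.2 (2), §3 Prop. 3.7 (2) (p. 240)] [cite: MilneADT2006, Ch. I §6, Thm. 6.13(a)] -/
theorem card_sha_three_primary_le_of_classX11b_of_kodairaNeron_rat_index_of_localDuality_of_prop37 [NeZero N]
    [W.IsGloballyMinimal] (hW : ClassX11b W 3) (hN : ∀ [W.IsElliptic], N = W.conductorNorm ℤ)
    (hKN3m : ∀ [W.IsElliptic] (v : HeightOneSpectrum (𝓞 ℚ)),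
      W.HasMultiplicativeReductionAt v → ¬ 3 ∣ W.ordMinimalDiscriminant v)
    (hKN3a : ∀ [W.IsElliptic] (v : HeightOneSpectrum (𝓞 ℚ)), W.HasAdditiveReductionAt v →
      W.kodairaSymbolAt v ≠ KodairaSymbol.IV ∧ W.kodairaSymbolAt v ≠ KodairaSymbol.IVstar)
    (hγ : prop37_2_reductionCongruence N W K 3) :
    ∀ [W.IsElliptic] (_hK : IsImaginaryQuadratic K) (_hH : SatisfiesHeegnerHypothesis N K)
      {P : (W.baseChange K).toAffine.Point} (_hP : IsHeegnerPoint N W K P)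
      (_hnt : ¬ IsOfFinAddOrder P) (_hidx : (AddSubgroup.zmultiples P).index ≠ 0)
      {M₀ : ℕ} (_hv : padicValNat 3 (AddSubgroup.zmultiples P).index = M₀) [NeZero (3 ^ M₀)]
      {c : K ≃ₐ[ℚ] K} (_hc : c ≠ 1) (_hcc : c * c = 1)
      (e : geomTorsion (W.baseChange K) ((3 ^ M₀ * 3 ^ M₀ : ℕ) : ℤ) →
        geomTorsion (W.baseChange K) ((3 ^ M₀ * 3 ^ M₀ : ℕ) : ℤ) → AlgebraicClosure K)
      (hμ : ∀ S T, e S T ^ (3 ^ M₀ * 3 ^ M₀) = 1)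
      (hadd₁ : ∀ S₁ S₂ T, e (S₁ + S₂) T = e S₁ T * e S₂ T)
      (hadd₂ : ∀ S T₁ T₂, e S (T₁ + T₂) = e S T₁ * e S T₂)
      (hgal : ∀ (σ : absoluteGaloisGroup K) (S T : geomTorsion (W.baseChange K) ((3 ^ M₀ * 3 ^ M₀ : ℕ) : ℤ)),
        σ • e S T = e (σ • S) (σ • T))
      (halt : ∀ T, e T T = 1) (hnondeg : ∀ T, (∀ S, e S T = 1) → T = 0)
      (inv : LocalInvariants K (3 ^ M₀ * 3 ^ M₀)) (hPT' : inv.SumInvLocalizationEqZero)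
      (hinv : ∀ v : HeightOneSpectrum (𝓞 K), Injective (inv (Sum.inr v)))
      (hH3 : ∀ x : galoisCohomology (mu K (3 ^ M₀ * 3 ^ M₀)) 3,
        (∀ v : Place K, galoisCohomology.localization (mu K (3 ^ M₀ * 3 ^ M₀)) v 3 x = 0) → x = 0)
      (hB : Literature.GroupTheory.FiniteAbelian.IsLevelPairing (3 ^ M₀)
        (ctLevelPairing (W.baseChange K) (3 ^ M₀) e hμ hadd₁ hadd₂ hgal inv halt hPT' hH3
          (localTerm_finite_support (W := W.baseChange K) (m := 3 ^ M₀) (e := e) (hμ := hμ)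
            (hadd₁ := hadd₁) (hadd₂ := hadd₂) (hgal := hgal) halt inv)))
      (hPτ : ∀ z ∈ selmerGroup (W.baseChange K) ((3 ^ M₀ * 3 ^ M₀ : ℕ) : ℤ),
        ∀ t ∈ selmerGroup (W.baseChange K) ((3 ^ M₀ * 3 ^ M₀ : ℕ) : ℤ),
        ctGeneralFun (W.baseChange K) (3 ^ M₀) e hμ hadd₁ hadd₂ hgal inv
            (torsionH1ToH1 (W.baseChange K) _ (conjAct W c _ z))
            (torsionH1ToH1 (W.baseChange K) _ (conjAct W c _ t)) =
          ctGeneralFun (W.baseChange K) (3 ^ M₀) e hμ hadd₁ hadd₂ hgal inv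
            (torsionH1ToH1 (W.baseChange K) _ z) (torsionH1ToH1 (W.baseChange K) _ t)),
      Finite (AddCommGroup.primaryComponent (W.baseChange K).sha 3) ∧
      (∀ c ∈ AddCommGroup.primaryComponent (W.baseChange K).sha 3, 3 ^ M₀ • c = 0) ∧
      Nat.card (AddCommGroup.primaryComponent (W.baseChange K).sha 3) ≤ 3 ^ (2 * M₀) ∧
      padicValNat 3 (Nat.card (AddCommGroup.primaryComponent (W.baseChange K).sha 3)) ≤ 2 * M₀ :=
  card_sha_three_primary_le_of_classX11b_of_kodairaNeron_rat_index_of_localDuality hW hN hKN3m hKN3a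
    (prop37_endBinder_three_of_classX11b hW hN hKN3m hγ)

end Summit.BirchSwinnertonDyer.Rank1Residual.X11b.Three.KolyvaginDischarged

end
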